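import Summits.CriticalPhenomena.SAWScalingLimit.Theorems.SAWDefectDecoherenceSpinShift
import Summits.CriticalPhenomena.SAWScalingLimit.Theorems.SAWDefectDecoherenceConjugateClassNegligibleSums
import Summits.CriticalPhenomena.SAWScalingLimit.Theorems.MassRatio.Negative.StarA
import HarnessLib

/-!
# The conjugate class IS the spin `σ - 2` alias: an exact dictionary for `ConjugateClassNegligible`

Route `SAWDefectDecoherence` of `CriticalPhenomena/SAWScalingLimit`, node `ConjugateClassNegligible`
(item `stmt-CriticalPhenomena-8551`). The numerator of the node is the `ū`-twisted (conjugate-class)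
average `Σ_{black v ∼ t} φ({v,t}) · conj(c_t - c_v) · F_{x,σ}({v,t})`. Two exact facts turn it
into the smeared spin-shifted observable:

* lattice geometry (`conj_hexCenter_sub_eq`): for a black vertex `v` and a neighbour `t`,
  `conj(c_t - c_v) = -i√3 · (c_t - c_v)²` — the three black→white edge vectors `d` have the same
  cube `d³ = i/(3√3)`, so `d̄ = |d|²/d = d²/(3d³)`;
* the spin-shift identity `SpinShift` (item stmt-8514, proved in
  `Theorems/SAWDefectDecoherenceSpinShift.lean`): `(c_t - c_v)² F_{x,σ}({v,t}) =
  (c_w - c_u)² F_{x,σ-2}({v,t})` for the boundary root `a = {u, w}`, `u ∉ Λ ∋ w`.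

Consequently (`conjClass_finsum_eq_alias_finsum`), for every weight `φ` on mid-edges,
`Σ_{pairs} φ conj(c_t - c_v) F_{x,σ} = -i√3 (c_w - c_u)² · Σ_{e ∈ Ω} φ(e) F_{x,σ-2}(e)`,
the sum over black→white ordered pairs of the statement being the sum over all domain mid-edges
(each edge of `ℍ` has exactly one black end, `image_mk_pairSet`). With `|3 (c_w - c_u)²| = 1`
this says: `ConjugateClassNegligible` is verbatim the statement that the `ψ`-smeared spin
`5/8 - 2 = -11/8` observable is `o(δ⁻²) F_δ(b_δ)` — the "winding alias" language of the sibling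
route `SAWWindingAlias` (its `AliasIdentity`/`TwistNull`), here pinned at `b` rather than at the root.
-/

noncomputable section

open scoped BigOperators
open Set
open Literature.Probability.LatticeModels Literature.Probability.RandomPlanarGeometry
open Literature.Probability.RandomPlanarGeometry.SAW
open Summit.CriticalPhenomena.SAWScalingLimit.Theses.SAWDefectDecoherence
open Summit.CriticalPhenomena.SAWScalingLimit.Theorems.ConjugateClassNegligibleSynthesis
open Summit.CriticalPhenomena.SAWScalingLimit.Theorems.MassRatio.Negative (conj_triZeta)

namespace Summit.CriticalPhenomena.SAWScalingLimit.Theorems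

namespace ConjugateClassNegligibleAlias

/-! ### The three black→white edge vectors -/

/-- `i√3 = 2ζ - 1`. [folklore] -/
theorem I_mul_sqrt_three : Complex.I * (Real.sqrt 3 : ℂ) = 2 * triZeta - 1 := by
  rw [triZeta_eq]
  apply Complex.ext
  · simp
  · simp; ring

/-- The conjugate of a black→white edge vector is `-i√3` times its square:
`conj(c_t - c_v) = -i√3 (c_t - c_v)²` for `v` black and `t ∼ v` (the three vectors are
`(1+ζ)/3, (ζ-2)/3, (1-2ζ)/3`; polynomial identities modulo `ζ² = ζ - 1`). [folklore] -/
theorem conj_hexCenter_sub_eq {v t : HexVertex} (hv : v.2 = 0) (h : hexGraph.Adj v t) :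
    (starRingEnd ℂ) (hexCenter t - hexCenter v) =
      -(Complex.I * Real.sqrt 3) * (hexCenter t - hexCenter v) ^ 2 := by
  obtain ⟨x, k⟩ := v
  simp only at hv
  subst hv
  have ht : t ∈ hexGraph.neighborSet ((x, 0) : HexVertex) := h
  rw [neighborSet_hexGraph_zero, Finset.mem_coe, Finset.mem_image] at ht
  obtain ⟨u, hu, rfl⟩ := ht
  have hd : hexCenter ((x + u, 1) : HexVertex) - hexCenter ((x, 0) : HexVertex) =
      triEmbed u + (1 + triZeta) / 3 := by
    simp only [hexCenter, triEmbed_add, Fin.val_one, Fin.val_zero, Nat.cast_one, Nat.cast_zero]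
    ring
  rw [hd, I_mul_sqrt_three]
  have hsq := triZeta_sq
  simp only [Finset.mem_insert, Finset.mem_singleton] at hu
  rcases hu with rfl | rfl | rfl
  · simp only [triEmbed_zero, zero_add, map_div₀, map_add, map_one, map_ofNat, conj_triZeta]
    linear_combination ((2 * triZeta + 5) / 9) * hsq
  · simp only [triEmbed_neg, triEmbed_single_zero, map_div₀, map_add, map_neg, map_one, map_ofNat,
      conj_triZeta]
    linear_combination ((2 * triZeta - 7) / 9) * hsq
  · simp only [triEmbed_neg, triEmbed_single_one, map_div₀, map_add, map_neg, map_one, map_ofNat,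
      conj_triZeta]
    linear_combination (4 * (2 * triZeta - 1) / 9) * hsq

/-! ### Black→white pairs versus domain mid-edges -/

/-- `(v, t) ↦ {v, t}` is injective on the black→white pair set of the statement (the honeycomb
lattice is bipartite). [folklore] -/
theorem injOn_mk_pairSet (Λ : Finset HexVertex) :
    InjOn (fun p : HexVertex × HexVertex => s(p.1, p.2))
      {p : HexVertex × HexVertex | s(p.1, p.2) ∈ hexDomainMidEdges Λ ∧ p.1.2 = 0} := by
  intro p hp q hq hpq
  simp only at hpq
  rcases Sym2.eq_iff.1 hpq with ⟨h1, h2⟩ | ⟨h1, h2⟩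
  · exact Prod.ext h1 h2
  · exfalso
    have hadj : hexGraph.Adj q.1 q.2 := (SimpleGraph.mem_edgeSet _).1 hq.1.1
    have hne := snd_ne_of_adj hadj
    rw [hq.2, ← h1, hp.2] at hne
    exact hne rfl

/-- Every domain mid-edge is `{v, t}` for exactly one black→white pair: the image of the pair set
of the statement is the set of domain mid-edges. [folklore] -/
theorem image_mk_pairSet (Λ : Finset HexVertex) :
    (fun p : HexVertex × HexVertex => s(p.1, p.2)) ''
        {p : HexVertex × HexVertex | s(p.1, p.2) ∈ hexDomainMidEdges Λ ∧ p.1.2 = 0} =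
      hexDomainMidEdges Λ := by
  ext e
  constructor
  · rintro ⟨p, hp, rfl⟩
    exact hp.1
  · intro he
    induction e using Sym2.ind with
    | h x y =>
      have hadj : hexGraph.Adj x y := (SimpleGraph.mem_edgeSet _).1 he.1
      have hne := snd_ne_of_adj hadj
      by_cases hx : x.2 = 0
      · exact ⟨(x, y), ⟨he, hx⟩, rfl⟩
      · have hy : y.2 = 0 := by
          have hx1 : x.2 = 1 := by
            rcases Fin.exists_fin_two.1 ⟨x.2, rfl⟩ with h0 | h1
            · exact absurd h0 hx
            · exact h1
          rcases Fin.exists_fin_two.1 ⟨y.2, rfl⟩ with h0 | h1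
          · exact h0
          · exact absurd (hx1.trans h1.symm) hne
        refine ⟨(y, x), ⟨?_, hy⟩, Sym2.eq_swap⟩
        simpa only [Sym2.eq_swap] using he

/-- A sum over the black→white pairs of a function of the edge is the sum over all domain
mid-edges. [folklore] -/
theorem finsum_pairSet_eq_finsum_midEdges (Λ : Finset HexVertex) (g : Sym2 HexVertex → ℂ) :
    ∑ᶠ p ∈ {p : HexVertex × HexVertex | s(p.1, p.2) ∈ hexDomainMidEdges Λ ∧ p.1.2 = 0},
        g s(p.1, p.2) =
      ∑ᶠ e ∈ hexDomainMidEdges Λ, g e := by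
  have h := finsum_mem_image (f := g) (injOn_mk_pairSet Λ)
  rw [image_mk_pairSet] at h
  exact h.symm

/-! ### The dictionary -/

/-- **Conjugate class = spin `σ - 2` alias (exact).** For a boundary root `a = {u, w}` (`u ∼ w`,
`u ∉ Λ ∋ w`), every weight `φ` on mid-edges, every fugacity `x` and spin `σ`:
`Σ_{black v ∼ t, {v,t} ∈ Ω} φ({v,t}) conj(c_t - c_v) F_{x,σ}({v,t})
  = -i√3 (c_w - c_u)² Σ_{e ∈ Ω} φ(e) F_{x,σ-2}(e)`.
(From `conj_hexCenter_sub_eq` and the proved route item `SpinShift`.) -/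
theorem conjClass_finsum_eq_alias_finsum {Λ : Finset HexVertex} {u w : HexVertex}
    (huw : hexGraph.Adj u w) (hu : u ∉ Λ) (hw : w ∈ Λ) (φ : Sym2 HexVertex → ℂ) (x σ : ℝ) :
    ∑ᶠ p ∈ {p : HexVertex × HexVertex | s(p.1, p.2) ∈ hexDomainMidEdges Λ ∧ p.1.2 = 0},
        φ s(p.1, p.2) * (starRingEnd ℂ) (hexCenter p.2 - hexCenter p.1) *
          hexParafermionicObservable Λ s(u, w) x σ s(p.1, p.2) =
      -(Complex.I * Real.sqrt 3) * (hexCenter w - hexCenter u) ^ 2 *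
        ∑ᶠ e ∈ hexDomainMidEdges Λ, φ e * hexParafermionicObservable Λ s(u, w) x (σ - 2) e := by
  have hS := SpinShift.spinShift_proof Λ u w huw hu hw
  rw [mul_finsum_mem, ← finsum_pairSet_eq_finsum_midEdges Λ]
  refine finsum_mem_congr rfl fun p hp => ?_
  have hadj : hexGraph.Adj p.1 p.2 := (SimpleGraph.mem_edgeSet _).1 hp.1.1
  have key := hS p.1 p.2 hadj x σ
  rw [conj_hexCenter_sub_eq hp.2 hadj]
  calc φ s(p.1, p.2) * (-(Complex.I * Real.sqrt 3) * (hexCenter p.2 - hexCenter p.1) ^ 2) *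
        hexParafermionicObservable Λ s(u, w) x σ s(p.1, p.2)
      = -(Complex.I * Real.sqrt 3) * φ s(p.1, p.2) *
          ((hexCenter p.2 - hexCenter p.1) ^ 2 *
            hexParafermionicObservable Λ s(u, w) x σ s(p.1, p.2)) := by ring
    _ = -(Complex.I * Real.sqrt 3) * φ s(p.1, p.2) *
          ((hexCenter w - hexCenter u) ^ 2 *
            hexParafermionicObservable Λ s(u, w) x (σ - 2) s(p.1, p.2)) := by rw [key]
    _ = -(Complex.I * Real.sqrt 3) * (hexCenter w - hexCenter u) ^ 2 *
          (φ s(p.1, p.2) * hexParafermionicObservable Λ s(u, w) x (σ - 2) s(p.1, p.2)) := by ring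

/-- The prefactor is a unit up to `√3`: `‖-i√3 (c_w - c_u)²‖ = 1/√3` for `u ∼ w` (the edge length
of `ℍ` is `1/√3`). [folklore] -/
theorem norm_prefactor_eq {u w : HexVertex} (huw : hexGraph.Adj u w) :
    ‖-(Complex.I * Real.sqrt 3) * (hexCenter w - hexCenter u) ^ 2‖ = 1 / Real.sqrt 3 := by
  have hsq : Complex.normSq (hexCenter w - hexCenter u) = 1 / 3 :=
    Summit.CriticalPhenomena.SAWScalingLimit.Cruxes.DefectDecoherence.TipMartingaleDepthInduction.WallExitTwoPoint.normSq_hexCenter_sub_of_adj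
      huw
  have hn : ‖hexCenter w - hexCenter u‖ ^ 2 = 1 / 3 := by
    rw [← Complex.normSq_eq_norm_sq]; exact hsq
  have h3 : (0 : ℝ) < Real.sqrt 3 := Real.sqrt_pos.2 (by norm_num)
  rw [norm_mul, norm_neg, norm_mul, Complex.norm_I, one_mul, Complex.norm_real,
    Real.norm_of_nonneg h3.le, norm_pow, hn]
  rw [eq_div_iff h3.ne', one_div, mul_comm, ← mul_assoc, ← sq, Real.sq_sqrt (by norm_num : (0 : ℝ) ≤ 3)]
  norm_num

/-- Two families with proportional norms (`‖u₁‖ = c ‖u₂‖` eventually, `c > 0`) tend to zero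
together. [folklore] -/
theorem tendsto_zero_iff_of_norm_eq {u₁ u₂ : ℝ → ℂ} {c : ℝ} (hc : 0 < c) {l : Filter ℝ}
    (h : ∀ᶠ δ in l, ‖u₁ δ‖ = c * ‖u₂ δ‖) :
    Filter.Tendsto u₁ l (nhds 0) ↔ Filter.Tendsto u₂ l (nhds 0) := by
  constructor
  · intro h1
    rw [tendsto_zero_iff_norm_tendsto_zero] at h1 ⊢
    have h2 : Filter.Tendsto (fun δ => c⁻¹ * ‖u₁ δ‖) l (nhds 0) := by
      simpa using h1.const_mul c⁻¹
    refine h2.congr' ?_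
    exact h.mono fun δ hδ => by
      show c⁻¹ * ‖u₁ δ‖ = ‖u₂ δ‖
      rw [hδ, ← mul_assoc, inv_mul_cancel₀ hc.ne', one_mul]
  · intro h2
    rw [tendsto_zero_iff_norm_tendsto_zero] at h2 ⊢
    have h1 : Filter.Tendsto (fun δ => c * ‖u₂ δ‖) l (nhds 0) := by
      simpa using h2.const_mul c
    refine h1.congr' ?_
    exact h.mono fun δ hδ => by
      show c * ‖u₂ δ‖ = ‖u₁ δ‖
      exact hδ.symm

end ConjugateClassNegligibleAlias

open ConjugateClassNegligibleAlias Filter Metric in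
/-- **`ConjugateClassNegligible` ⟺ the smeared spin `5/8 - 2 = -11/8` observable is negligible
against `F_δ(b_δ)`.** In the setting of the node (same hypotheses, same `C¹` test functions), the
conclusion `δ² Σ_{black v ∼ t} ψ(δ·mid) conj(c_t - c_v) F_{δ,5/8}({v,t}) / F_{δ,5/8}(b_δ) → 0` is
equivalent to `δ² Σ_{e ∈ Ω_δ} ψ(δ·mid e) F_{δ,5/8-2}(e) / F_{δ,5/8}(b_δ) → 0`: by
`conjClass_finsum_eq_alias_finsum` the two numerators differ, for every `δ` at which `a_δ` is a
boundary mid-edge, by the factor `-i√3 (c_w - c_u)²` of constant modulus `1/√3`. This is the exact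
bridge between this route's node and the "winding alias" formulation (sibling route
`SAWWindingAlias`, whose `TwistNull` controls the same smeared alias but rooted differently). -/
theorem conjugateClassNegligible_iff_alias :
    ConjugateClassNegligible ↔
    ∀ (D : DobrushinDomain) (ρ : ℝ) (Λ : ℝ → Finset HexVertex) (m : ℝ → ℤ)
      (a b : ℝ → Sym2 HexVertex) (ψ : ℂ → ℂ), 0 < ρ →
      D.carrier ∩ Metric.ball (D.pt 1) ρ = {z : ℂ | (D.pt 1).im < z.im} ∩ Metric.ball (D.pt 1) ρ →
      (∀ᶠ δ : ℝ in nhdsWithin 0 (Set.Ioi 0), hexDomainSimplyConnected (Λ δ) ∧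
        a δ ∈ hexDomainBoundary (Λ δ) ∧ b δ ∈ hexDomainBoundary (Λ δ) ∧
        Nonempty (HexMidEdgeSAW (Λ δ) (a δ) (b δ)) ∧
        (hexGraph.induce ((Λ δ : Finset HexVertex) : Set HexVertex)).Preconnected ∧
        (∀ v ∈ Λ δ, (δ : ℂ) * hexCenter v ∈ D.carrier) ∧
        (∀ v : HexVertex, (δ : ℂ) * hexCenter v ∈ Metric.ball (D.pt 1) ρ →
          (v ∈ Λ δ ↔ m δ ≤ v.1 1))) →
      (∀ K : Set ℂ, IsCompact K → K ⊆ D.carrier → ∀ᶠ δ : ℝ in nhdsWithin 0 (Set.Ioi 0),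
        ∀ v : HexVertex, (δ : ℂ) * hexCenter v ∈ K → v ∈ Λ δ) →
      Filter.Tendsto (fun δ : ℝ => (δ : ℂ) * hexMidpoint (a δ)) (nhdsWithin 0 (Set.Ioi 0))
        (nhds (D.pt 0)) →
      Filter.Tendsto (fun δ : ℝ => (δ : ℂ) * hexMidpoint (b δ)) (nhdsWithin 0 (Set.Ioi 0))
        (nhds (D.pt 1)) →
      ContDiff ℝ 1 ψ → HasCompactSupport ψ → tsupport ψ ⊆ D.carrier →
      Filter.Tendsto (fun δ : ℝ => (δ : ℂ) ^ 2 *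
          (∑ᶠ e ∈ hexDomainMidEdges (Λ δ), ψ ((δ : ℂ) * hexMidpoint e) *
            hexParafermionicObservable (Λ δ) (a δ) hexCriticalFugacity (5 / 8 - 2) e) /
          hexParafermionicObservable (Λ δ) (a δ) hexCriticalFugacity (5 / 8) (b δ))
        (nhdsWithin 0 (Set.Ioi 0)) (nhds 0) := by
  -- the eventual proportionality of the two numerators, for a fixed admissible family
  have key : ∀ (Λ : ℝ → Finset HexVertex) (a b : ℝ → Sym2 HexVertex) (ψ : ℂ → ℂ),
      (∀ᶠ δ : ℝ in nhdsWithin 0 (Set.Ioi 0), a δ ∈ hexDomainBoundary (Λ δ)) →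
      ∀ᶠ δ : ℝ in nhdsWithin 0 (Set.Ioi 0),
        ‖(δ : ℂ) ^ 2 * (∑ᶠ p ∈ {p : HexVertex × HexVertex |
              s(p.1, p.2) ∈ hexDomainMidEdges (Λ δ) ∧ p.1.2 = 0},
            ψ ((δ : ℂ) * hexMidpoint s(p.1, p.2)) *
              (starRingEnd ℂ) (hexCenter p.2 - hexCenter p.1) *
                hexParafermionicObservable (Λ δ) (a δ) hexCriticalFugacity (5 / 8) s(p.1, p.2)) /
            hexParafermionicObservable (Λ δ) (a δ) hexCriticalFugacity (5 / 8) (b δ)‖ =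
          1 / Real.sqrt 3 * ‖(δ : ℂ) ^ 2 *
            (∑ᶠ e ∈ hexDomainMidEdges (Λ δ), ψ ((δ : ℂ) * hexMidpoint e) *
              hexParafermionicObservable (Λ δ) (a δ) hexCriticalFugacity (5 / 8 - 2) e) /
            hexParafermionicObservable (Λ δ) (a δ) hexCriticalFugacity (5 / 8) (b δ)‖ := by
    intro Λ a b ψ hev
    refine hev.mono fun δ hδ => ?_
    obtain ⟨hae, u, w, hauw, hw, hu⟩ := hδ
    rw [hauw] at hae ⊢
    have huw : hexGraph.Adj u w := (SimpleGraph.mem_edgeSet _).1 hae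
    have hid := conjClass_finsum_eq_alias_finsum (Λ := Λ δ) huw hu hw
      (fun e => ψ ((δ : ℂ) * hexMidpoint e)) hexCriticalFugacity (5 / 8)
    beta_reduce at hid
    rw [hid, ← norm_prefactor_eq huw, ← norm_mul]
    congr 1
    ring
  constructor
  · intro h D ρ Λ m a b ψ hρ hflat hev hexh ha hb hψ1 hψc hψs
    have h1 := h D ρ Λ m a b ψ
    dsimp only at h1
    have T := h1 hρ hflat hev hexh ha hb hψ1 hψc hψs
    have hsq : (0 : ℝ) < 1 / Real.sqrt 3 := by
      have : (0 : ℝ) < Real.sqrt 3 := Real.sqrt_pos.2 (by norm_num)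
      positivity
    exact (tendsto_zero_iff_of_norm_eq hsq
      (key Λ a b ψ (hev.mono fun δ hδ => hδ.2.1))).1 T
  · intro h D ρ Λ m a b ψ
    dsimp only
    intro hρ hflat hev hexh ha hb hψ1 hψc hψs
    have T := h D ρ Λ m a b ψ hρ hflat hev hexh ha hb hψ1 hψc hψs
    have hsq : (0 : ℝ) < 1 / Real.sqrt 3 := by
      have : (0 : ℝ) < Real.sqrt 3 := Real.sqrt_pos.2 (by norm_num)
      positivity
    exact (tendsto_zero_iff_of_norm_eq hsq
      (key Λ a b ψ (hev.mono fun δ hδ => hδ.2.1))).2 T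

end Summit.CriticalPhenomena.SAWScalingLimit.Theorems
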